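import Summits.AnomalousDissipation.AnomalousDissipation.Theorems.MarginalStabilityChainBurgersLayerKHStubStrainedD

/-!
# Line `Sketch`, stub `stub_strained` (lead) — part E

part E: `exists_slowFixedPoint` — the strained slow mode as the fixed point of the contraction
`n ↦ S_λ[1 - h J(n)]/(1+|y|)` on `ℝ →ᵇ ℂ` (Volterra solution operator `S_λ`, resolvent correction `J` bounded by the
integration by parts of part C), for `0 < h ≤ h₀` uniformly in `re λ ≥ ℓ`.
-/

set_option linter.dupNamespace false

noncomputable section

open Complex MeasureTheory Filter Topology Set Metric intervalIntegral

namespace Summit.AnomalousDissipation.AnomalousDissipation.Theorems.BurgersLayerKH.Sheet.Strained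

/-- **Existence of the strained slow mode as a fixed point.**  For `α ∈ (0,1]`, `ℓ > 0`, the
weighted Volterra theory (`k = 1`, `A = 1/ℓ`), the Gaussian-class resolvent with `h`-uniform bound
and its uniqueness, there are `h₀ > 0` and `C_m` such that for `0 < h ≤ h₀` and `re λ ≥ ℓ` there is
a continuous, linearly bounded `m` (`‖m‖ ≤ C_m(1+|y|)`) with
`m = 1 - ∫_{t>y} k_α(t-y) e^{αt} Ω(t) dt`, where `Ω` is the Gaussian-class resolvent solution with
source `-iU''e^{-αt}m`: the fixed point of the contraction `n ↦ S_λ[1 - h J(n)]/(1+|y|)` on bounded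
continuous functions (`S_λ` the Volterra solution operator, `‖h J(n)‖ ≤ h C⋆ K e⁹‖n‖/ℓ` by the
integration by parts). [folklore] -/
theorem exists_slowFixedPoint {α ℓ K : ℝ} (hα : 0 < α) (hα1 : α ≤ 1) (hℓ : 0 < ℓ) (hVolt : VolterraPackage 1 (1 / ℓ)) (hRes : ResolventBound K) (hUq : ∀ lam : ℂ, 0 < lam.re → ∀ h : ℝ, 0 < h → ResolventUniqueAt α h lam) : ∃ h₀ : ℝ, 0 < h₀ ∧ ∃ Cm : ℝ, 0 ≤ Cm ∧ ∀ h : ℝ, 0 < h → h ≤ h₀ → ∀ lam : ℂ, ℓ ≤ lam.re → ∃ m Ω : ℝ → ℂ, Continuous m ∧ (∀ y, ‖m y‖ ≤ Cm * (1 + |y|)) ∧ IsResolventSol α h lam (fun t => -(I * Upp t) * ((Real.exp (-(α * t)) : ℂ) * m t)) Ω ∧ GaussBound Ω (|K| * Real.exp 9 * Cm / ℓ) ∧ ∀ y, m y = 1 - ∫ t in Ioi y, (volterraKernel α (t - y) : ℂ) * ((Real.exp (α * t) : ℂ) * Ω t) := by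
  obtain ⟨CV, hCV⟩ := hVolt
  obtain ⟨Cstar, hCstar0, hIBP⟩ := ibp_estimate hα hℓ
  -- constants
  set CV' : ℝ := max CV 1 with hCV'
  have hCV'1 : 1 ≤ CV' := le_max_right _ _
  have hCV'0 : 0 < CV' := lt_of_lt_of_le zero_lt_one hCV'1
  set cJ : ℝ := Cstar * |K| * Real.exp 9 / ℓ with hcJ
  have hcJ0 : 0 ≤ cJ := by positivity
  set h₀ : ℝ := min ℓ (1 / (2 * CV' * cJ + 1)) with hh₀
  have hh₀pos : 0 < h₀ := lt_min hℓ (by positivity)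
  refine ⟨h₀, hh₀pos, 2 * CV', by positivity, ?_⟩
  intro h hh hhle lam hlam
  have hlam0 : 0 < lam.re := hℓ.trans_le hlam
  have hhℓ : h ≤ lam.re := (hhle.trans (min_le_left _ _)).trans hlam
  have hhsmall : 2 * CV' * cJ * h ≤ 1 := by
    have h1 : h ≤ 1 / (2 * CV' * cJ + 1) := hhle.trans (min_le_right _ _)
    rw [le_div_iff₀ (by positivity)] at h1
    nlinarith
  -- the Rayleigh potential
  obtain ⟨V, hV⟩ : ∃ V : ℝ → ℂ, V = fun t => I * (Upp t : ℂ) / (lam + I * (U t : ℂ)) := ⟨_, rfl⟩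
  have hden : ∀ t, lam + I * (U t : ℂ) ≠ 0 := lam_add_ne_zero hlam0
  have hVc : Continuous V := by
    rw [hV]
    have hc1 := SheetLimit.continuous_Upp
    have hc2 := differentiable_U.continuous
    refine Continuous.div (by fun_prop) (by fun_prop) hden
  have hVb : ∀ t, ‖V t‖ ≤ 1 / ℓ * Real.exp (-(t ^ 2) / 4) := by
    intro t
    rw [hV]; simp only
    rw [norm_div, norm_mul, Complex.norm_I, one_mul, Complex.norm_real, Real.norm_eq_abs]
    have hUpp : |Upp t| = |t| * Real.exp (-(t ^ 2) / 2) := by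
      rw [Upp, abs_neg, abs_mul, abs_of_pos (Real.exp_pos _)]
    have hte : |t| * Real.exp (-(t ^ 2) / 2) ≤ Real.exp (-(t ^ 2) / 4) := by
      have h1 : |t| ≤ Real.exp (t ^ 2 / 4) := by
        have := Real.add_one_le_exp (t ^ 2 / 4)
        nlinarith [sq_nonneg (|t| - 2), sq_abs t]
      calc |t| * Real.exp (-(t ^ 2) / 2) ≤ Real.exp (t ^ 2 / 4) * Real.exp (-(t ^ 2) / 2) :=
            mul_le_mul_of_nonneg_right h1 (Real.exp_pos _).le
        _ = Real.exp (-(t ^ 2) / 4) := by rw [← Real.exp_add]; congr 1; ring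
    rw [hUpp, div_eq_mul_inv, mul_comm, one_div]
    exact mul_le_mul (inv_anti₀ hℓ (hlam.trans (re_le_norm_lam_add lam t))) hte (by positivity)
      (by positivity)
  -- the weight `1 + |y|` and the objects attached to a bounded continuous `n`
  have hw : ∀ y : ℝ, (0 : ℝ) < 1 + |y| := fun y => by positivity
  have hwc : Continuous (fun y : ℝ => (((1 + |y| : ℝ)) : ℂ)) := by fun_prop
  set mOf : BoundedContinuousFunction ℝ ℂ → ℝ → ℂ := fun n y => ((1 + |y| : ℝ) : ℂ) * n y with hmOf
  have hmOfc : ∀ n, Continuous (mOf n) := fun n => hwc.mul n.continuous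
  have hmOfb : ∀ n : BoundedContinuousFunction ℝ ℂ, ∀ y, ‖mOf n y‖ ≤ ‖n‖ * (1 + |y|) := by
    intro n y
    simp only [hmOf]
    rw [norm_mul, Complex.norm_real, Real.norm_of_nonneg (hw y).le, mul_comm]
    exact mul_le_mul_of_nonneg_right (n.norm_coe_le_norm y) (hw y).le
  set FOf : BoundedContinuousFunction ℝ ℂ → ℝ → ℂ :=
    fun n t => -(I * Upp t) * ((Real.exp (-(α * t)) : ℂ) * mOf n t) with hFOf
  have hFOfc : ∀ n, Continuous (FOf n) := fun n => by
    have h1 := hmOfc n; have h2 := SheetLimit.continuous_Upp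
    simp only [hFOf]; fun_prop
  have hFOfb : ∀ n : BoundedContinuousFunction ℝ ℂ, GaussBound (FOf n) (Real.exp 9 * ‖n‖) := fun n =>
    gaussBound_source hα.le hα1 (hmOfb n)
  -- the resolvent solutions
  have hωex : ∀ n : BoundedContinuousFunction ℝ ℂ, ∃ ω, IsResolventSol α h lam (FOf n) ω ∧
      GaussBound ω (K * (Real.exp 9 * ‖n‖) / lam.re) :=
    fun n => hRes α hα hα1 lam hlam0 h hh hhℓ (FOf n) (hFOfc n) _ (hFOfb n)
  choose ωOf hωOf using hωex
  have hωG : ∀ n : BoundedContinuousFunction ℝ ℂ, GaussBound (ωOf n) (|K| * Real.exp 9 * ‖n‖ / ℓ) := by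
    intro n
    refine GaussBound.mono (hωOf n).2 ?_
    have h1 : K * (Real.exp 9 * ‖n‖) / lam.re ≤ |K| * (Real.exp 9 * ‖n‖) / lam.re :=
      div_le_div_of_nonneg_right (mul_le_mul_of_nonneg_right (le_abs_self K) (by positivity)) hlam0.le
    refine h1.trans ?_
    rw [mul_assoc |K|, ← mul_assoc]
    exact div_le_div_of_nonneg_left (by positivity) hℓ hlam
  -- linearity of `n ↦ ωOf n` (uniqueness)
  have hωsub : ∀ n₁ n₂ : BoundedContinuousFunction ℝ ℂ, ωOf (n₁ - n₂) = fun t => ωOf n₁ t - ωOf n₂ t := by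
    intro n₁ n₂
    have hF : FOf (n₁ - n₂) = fun t => FOf n₁ t + (-1) * FOf n₂ t := by
      funext t; simp only [hFOf, hmOf, BoundedContinuousFunction.coe_sub, Pi.sub_apply]; ring
    have h2 : IsResolventSol α h lam (fun t => FOf n₁ t + (-1) * FOf n₂ t) (fun t => ωOf n₁ t + (-1) * ωOf n₂ t) :=
      resSol_add (hωOf n₁).1 (resSol_smul (hωOf n₂).1 (-1))
    rw [← hF] at h2
    have := resSol_unique (hUq lam hlam0 h hh) (hωOf (n₁ - n₂)).1 h2
    rw [this]; funext t; ring
  -- the correction J(n) and its bound (integration by parts)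
  set JOf : BoundedContinuousFunction ℝ ℂ → ℝ → ℂ := fun n y => ∫ t in Ioi y,
      (volterraKernel α (t - y) : ℂ) * (Real.exp (α * t) : ℂ) * (ou α (ωOf n) t / (lam + I * U t)) with hJOf
  have hJb : ∀ n : BoundedContinuousFunction ℝ ℂ, ∀ y, ‖JOf n y‖ ≤ cJ * ‖n‖ := by
    intro n y
    obtain ⟨D, -, hD⟩ := resSol_deriv_decay (hωOf n).1 hh.ne' (hFOfb n)
    obtain ⟨D', hD'⟩ := ou_bound_of_resSol (hωOf n).1 hh (hFOfb n) (hωG n)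
    have := hIBP lam hlam (ωOf n) (hωOf n).1.1 _ D D' (hωG n) hD hD' y
    simp only [hJOf]
    refine this.trans (le_of_eq ?_)
    rw [hcJ]; field_simp
  -- the integrand of `J(n)` is of `peg` class; continuity of `J(n)`; linearity of `J`
  have hq : ∀ n : BoundedContinuousFunction ℝ ℂ, Continuous (fun t => ou α (ωOf n) t / (lam + I * U t)) ∧
      ∃ M : ℝ, ∀ t, ‖ou α (ωOf n) t / (lam + I * U t)‖ ≤ M * (1 + |t|) * Real.exp (-(t ^ 2) / 4) := by
    intro n
    obtain ⟨D', hD'⟩ := ou_bound_of_resSol (hωOf n).1 hh (hFOfb n) (hωG n)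
    refine ⟨Continuous.div (continuous_ou (hωOf n).1.1) (by have := differentiable_U.continuous; fun_prop) hden,
      D' / ℓ, fun t => ?_⟩
    rw [norm_div]
    have hD'0 : 0 ≤ D' * (1 + |t|) * Real.exp (-(t ^ 2) / 4) := (norm_nonneg _).trans (hD' t)
    calc ‖ou α (ωOf n) t‖ / ‖lam + I * U t‖ ≤ (D' * (1 + |t|) * Real.exp (-(t ^ 2) / 4)) / ℓ :=
          div_le_div₀ hD'0 (hD' t) hℓ (hlam.trans (re_le_norm_lam_add lam t))
      _ = D' / ℓ * (1 + |t|) * Real.exp (-(t ^ 2) / 4) := by ring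
  have hJc : ∀ n : BoundedContinuousFunction ℝ ℂ, Continuous (JOf n) := by
    intro n
    obtain ⟨hqc, M, hqb⟩ := hq n
    set f : ℝ → ℂ := fun t => (Real.exp (α * t) : ℂ) * (ou α (ωOf n) t / (lam + I * U t)) with hf
    have hfc : Continuous f := by simp only [hf]; fun_prop
    have hM : 0 ≤ M := by have := (norm_nonneg _).trans (hqb 0); simpa using this
    have hfb : ∀ t, ‖f t‖ ≤ M * ((1 + |t|) ^ 1 * Real.exp (α * t) * Real.exp (-(t ^ 2) / 4)) := by
      intro t
      simp only [hf]; rw [norm_mul, Complex.norm_real, Real.norm_of_nonneg (Real.exp_pos _).le, pow_one]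
      calc Real.exp (α * t) * ‖ou α (ωOf n) t / (lam + I * U t)‖
          ≤ Real.exp (α * t) * (M * (1 + |t|) * Real.exp (-(t ^ 2) / 4)) := mul_le_mul_of_nonneg_left (hqb t) (Real.exp_pos _).le
        _ = M * ((1 + |t|) * Real.exp (α * t) * Real.exp (-(t ^ 2) / 4)) := by ring
    obtain ⟨hfi, hgi⟩ := integrable_peg hfc hfb (-(2 * α))
    have hgi' : Integrable fun t => (Real.exp (-(2 * α * t)) : ℂ) * f t := by
      refine hgi.congr (Filter.Eventually.of_forall fun t => ?_); simp only; congr 2; ring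
    have hm : ∀ y, JOf n y = 0 + ∫ t in Ioi y, (volterraKernel α (t - y) : ℂ) * f t := by
      intro y; simp only [hJOf, hf, zero_add]; congr 1; funext t; ring
    obtain ⟨DJ, hDJ, -, -, -⟩ := volterra_regularity hα hfc hfi hgi' 0 hm
    exact continuous_iff_continuousAt.2 fun y => (hDJ y).continuousAt
  have hJint : ∀ n : BoundedContinuousFunction ℝ ℂ, ∀ y, IntegrableOn (fun t => (volterraKernel α (t - y) : ℂ) *
      (Real.exp (α * t) : ℂ) * (ou α (ωOf n) t / (lam + I * U t))) (Ioi y) := by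
    intro n y
    obtain ⟨hqc, M, hqb⟩ := hq n
    exact integrableOn_kernel_exp hα hqc hqb y
  have hJsub : ∀ n₁ n₂ : BoundedContinuousFunction ℝ ℂ, ∀ y, JOf n₁ y - JOf n₂ y = JOf (n₁ - n₂) y := by
    intro n₁ n₂ y
    simp only [hJOf]
    rw [← integral_sub (hJint n₁ y) (hJint n₂ y)]
    congr 1; funext t
    rw [hωsub, ou_sub (hωOf n₁).1.1 (hωOf n₂).1.1]
    ring
  -- the Volterra sources `g(n) = 1 - h J(n)` and solutions
  set G : BoundedContinuousFunction ℝ ℂ → ℝ := fun n => 1 + h * cJ * ‖n‖ with hG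
  have hG1 : ∀ n, 1 ≤ G n := fun n => by
    have := mul_nonneg (mul_nonneg hh.le hcJ0) (norm_nonneg n)
    simp only [hG]; linarith
  have hG0 : ∀ n, 0 < G n := fun n => lt_of_lt_of_le zero_lt_one (hG1 n)
  set gOf : BoundedContinuousFunction ℝ ℂ → ℝ → ℂ := fun n y => 1 - (h : ℂ) * JOf n y with hgOf
  have hgc : ∀ n, Continuous (gOf n) := fun n => by
    have := hJc n; simp only [hgOf]; fun_prop
  have hgb : ∀ n y, ‖gOf n y‖ ≤ G n := by
    intro n y
    simp only [hgOf, hG]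
    calc ‖(1 : ℂ) - (h : ℂ) * JOf n y‖ ≤ ‖(1 : ℂ)‖ + ‖(h : ℂ) * JOf n y‖ := norm_sub_le _ _
      _ ≤ 1 + h * (cJ * ‖n‖) := by
          rw [norm_one, norm_mul, Complex.norm_real, Real.norm_of_nonneg hh.le]
          exact add_le_add le_rfl (mul_le_mul_of_nonneg_left (hJb n y) hh.le)
      _ = 1 + h * cJ * ‖n‖ := by ring
  have hsex : ∀ n : BoundedContinuousFunction ℝ ℂ, ∃ s : ℝ → ℂ, Continuous s ∧
      (∀ y, ‖s y‖ ≤ CV * (1 + |y|) ^ 1) ∧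
      ∀ y, s y = gOf n y / (G n : ℂ) + ∫ t in Ioi y, (volterraKernel α (t - y) : ℂ) * V t * s t := by
    intro n
    refine (hCV α hα.le hα1 V hVc hVb (fun y => gOf n y / (G n : ℂ)) ((hgc n).div_const _) fun y => ?_).1
    rw [norm_div, Complex.norm_real, Real.norm_of_nonneg (hG0 n).le, pow_one, div_le_iff₀ (hG0 n)]
    calc ‖gOf n y‖ ≤ G n := hgb n y
      _ ≤ (1 + |y|) * G n := le_mul_of_one_le_left (hG0 n).le (by linarith [abs_nonneg y])
  choose sOf' hsOf' using hsex
  set sOf : BoundedContinuousFunction ℝ ℂ → ℝ → ℂ := fun n y => (G n : ℂ) * sOf' n y with hsOf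
  have hsc : ∀ n, Continuous (sOf n) := fun n => continuous_const.mul (hsOf' n).1
  have hsb : ∀ n y, ‖sOf n y‖ ≤ CV' * G n * (1 + |y|) := by
    intro n y
    simp only [hsOf]
    rw [norm_mul, Complex.norm_real, Real.norm_of_nonneg (hG0 n).le]
    have := (hsOf' n).2.1 y
    rw [pow_one] at this
    calc G n * ‖sOf' n y‖ ≤ G n * (CV * (1 + |y|)) := mul_le_mul_of_nonneg_left this (hG0 n).le
      _ ≤ G n * (CV' * (1 + |y|)) := by gcongr; exact le_max_left _ _
      _ = CV' * G n * (1 + |y|) := by ring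
  have hseq : ∀ n y, sOf n y = gOf n y + ∫ t in Ioi y, (volterraKernel α (t - y) : ℂ) * V t * sOf n t := by
    intro n y
    have hne : (G n : ℂ) ≠ 0 := by exact_mod_cast (hG0 n).ne'
    simp only [hsOf]
    rw [(hsOf' n).2.2 y, mul_add, mul_div_cancel₀ _ hne, ← MeasureTheory.integral_const_mul]
    congr 1
    exact integral_congr_ae (Filter.Eventually.of_forall fun t => by simp only; ring)
  -- the self-map `Φ` of bounded continuous functions and its contraction property
  have hΦb : ∀ n y, ‖sOf n y / ((1 + |y| : ℝ) : ℂ)‖ ≤ CV' * G n := by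
    intro n y
    rw [norm_div, Complex.norm_real, Real.norm_of_nonneg (hw y).le, div_le_iff₀ (hw y)]
    exact hsb n y
  set Φ : BoundedContinuousFunction ℝ ℂ → BoundedContinuousFunction ℝ ℂ := fun n =>
    BoundedContinuousFunction.ofNormedAddCommGroup (fun y => sOf n y / ((1 + |y| : ℝ) : ℂ))
      ((hsc n).div hwc fun y => by exact_mod_cast (hw y).ne') (CV' * G n) (hΦb n) with hΦ
  have hΦapply : ∀ n y, Φ n y = sOf n y / ((1 + |y| : ℝ) : ℂ) := fun n y => rfl
  -- a priori bound for differences of Volterra solutions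
  have hdiff : ∀ n₁ n₂ : BoundedContinuousFunction ℝ ℂ, ∀ y,
      ‖sOf n₁ y - sOf n₂ y‖ ≤ CV' * (h * cJ * ‖n₁ - n₂‖) * (1 + |y|) := by
    intro n₁ n₂
    set d : ℝ → ℂ := fun y => sOf n₁ y - sOf n₂ y with hd
    set src : ℝ → ℂ := fun y => -(h : ℂ) * JOf (n₁ - n₂) y with hsrc
    have hdc : Continuous d := (hsc n₁).sub (hsc n₂)
    have hdb : ∃ B : ℝ, ∀ y, ‖d y‖ ≤ B * (1 + |y|) ^ 1 := by
      refine ⟨CV' * G n₁ + CV' * G n₂, fun y => ?_⟩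
      rw [pow_one]
      calc ‖d y‖ ≤ ‖sOf n₁ y‖ + ‖sOf n₂ y‖ := norm_sub_le _ _
        _ ≤ CV' * G n₁ * (1 + |y|) + CV' * G n₂ * (1 + |y|) := add_le_add (hsb n₁ y) (hsb n₂ y)
        _ = (CV' * G n₁ + CV' * G n₂) * (1 + |y|) := by ring
    have hdeq : ∀ y, d y = src y + ∫ t in Ioi y, (volterraKernel α (t - y) : ℂ) * V t * d t := by
      intro y
      have hi1 := integrableOn_kernel hα hVc hVb (hsc n₁) (hsb n₁) y
      have hi2 := integrableOn_kernel hα hVc hVb (hsc n₂) (hsb n₂) y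
      simp only [hd, hsrc]
      rw [hseq n₁ y, hseq n₂ y]
      have : (∫ t in Ioi y, (volterraKernel α (t - y) : ℂ) * V t * (sOf n₁ t - sOf n₂ t)) =
          (∫ t in Ioi y, (volterraKernel α (t - y) : ℂ) * V t * sOf n₁ t) -
            ∫ t in Ioi y, (volterraKernel α (t - y) : ℂ) * V t * sOf n₂ t := by
        rw [← integral_sub hi1 hi2]; congr 1; funext t; ring
      rw [this]
      simp only [hgOf]
      rw [← hJsub n₁ n₂ y]
      ring
    set Gd : ℝ := h * cJ * ‖n₁ - n₂‖ with hGd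
    have hGd0 : 0 ≤ Gd := by positivity
    have hsrcb : ∀ y, ‖src y‖ ≤ Gd := by
      intro y
      simp only [hsrc, hGd]
      rw [norm_mul, norm_neg, Complex.norm_real, Real.norm_of_nonneg hh.le, mul_assoc]
      exact mul_le_mul_of_nonneg_left (hJb _ y) hh.le
    have hsrcc : Continuous src := by have := hJc (n₁ - n₂); simp only [hsrc]; fun_prop
    intro y
    rcases hGd0.eq_or_lt with hG0' | hGpos
    · -- source zero: `d = 0` by uniqueness
      have hsrc0 : ∀ y, src y = 0 := fun y => norm_le_zero_iff.1 (by rw [hG0']; exact hsrcb y)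
      have hpkg := (hCV α hα.le hα1 V hVc hVb (fun _ => (0 : ℂ)) continuous_const
        (fun y => by rw [norm_zero]; positivity)).2
      have hzero : d = fun _ => 0 := hpkg d (fun _ => 0) hdc continuous_const hdb ⟨0, fun y => by simp⟩
        (fun y => by rw [hdeq y, hsrc0 y]) (fun y => by simp)
      have : d y = 0 := by rw [hzero]
      simp only [hd] at this
      rw [this, norm_zero]; positivity
    · -- normalise the source and compare with the package solution
      obtain ⟨⟨s, hsc', hsb', hseq'⟩, huniq⟩ := hCV α hα.le hα1 V hVc hVb (fun y => src y / (Gd : ℂ))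
        (hsrcc.div_const _) (fun y => by
          rw [norm_div, Complex.norm_real, Real.norm_of_nonneg hGpos.le, pow_one, div_le_iff₀ hGpos]
          calc ‖src y‖ ≤ Gd := hsrcb y
            _ ≤ (1 + |y|) * Gd := le_mul_of_one_le_left hGpos.le (by linarith [abs_nonneg y]))
      have hne : (Gd : ℂ) ≠ 0 := by exact_mod_cast hGpos.ne'
      -- `d / Gd` solves the normalised equation
      have hd' : ∀ y, (fun y => d y / (Gd : ℂ)) y = src y / (Gd : ℂ) +
          ∫ t in Ioi y, (volterraKernel α (t - y) : ℂ) * V t * (fun y => d y / (Gd : ℂ)) t := by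
        intro y
        simp only
        rw [hdeq y, add_div]
        congr 1
        rw [div_eq_mul_inv, ← MeasureTheory.integral_mul_const]
        exact integral_congr_ae (Filter.Eventually.of_forall fun t => by simp only; ring)
      have hdb' : ∃ B : ℝ, ∀ y, ‖(fun y => d y / (Gd : ℂ)) y‖ ≤ B * (1 + |y|) ^ 1 := by
        obtain ⟨B, hB⟩ := hdb
        refine ⟨B / Gd, fun y => ?_⟩
        simp only; rw [norm_div, Complex.norm_real, Real.norm_of_nonneg hGpos.le, div_mul_eq_mul_div]
        exact div_le_div_of_nonneg_right (hB y) hGpos.le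
      have heq := huniq (fun y => d y / (Gd : ℂ)) s ((hdc.div_const _)) hsc' hdb' ⟨CV, hsb'⟩ hd' hseq'
      have hdy : d y = (Gd : ℂ) * s y := by
        have := congrFun heq y
        beta_reduce at this
        rw [← this, mul_div_cancel₀ _ hne]
      have := hsb' y
      rw [pow_one] at this
      simp only [hd] at hdy
      rw [hdy, norm_mul, Complex.norm_real, Real.norm_of_nonneg hGpos.le]
      calc Gd * ‖s y‖ ≤ Gd * (CV * (1 + |y|)) := mul_le_mul_of_nonneg_left this hGpos.le
        _ ≤ Gd * (CV' * (1 + |y|)) := by gcongr; exact le_max_left _ _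
        _ = CV' * Gd * (1 + |y|) := by ring
  have hcontr : ContractingWith (1 / 2) Φ := by
    refine ⟨NNReal.half_lt_self one_ne_zero, LipschitzWith.of_dist_le_mul fun n₁ n₂ => ?_⟩
    rw [show ((1 / 2 : NNReal) : ℝ) = 1 / 2 by norm_num]
    refine (BoundedContinuousFunction.dist_le (by positivity)).2 fun y => ?_
    rw [dist_eq_norm, hΦapply, hΦapply, ← sub_div, norm_div, Complex.norm_real,
      Real.norm_of_nonneg (hw y).le, div_le_iff₀ (hw y), dist_eq_norm]
    calc ‖sOf n₁ y - sOf n₂ y‖ ≤ CV' * (h * cJ * ‖n₁ - n₂‖) * (1 + |y|) := hdiff n₁ n₂ y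
      _ = (CV' * cJ * h) * ‖n₁ - n₂‖ * (1 + |y|) := by ring
      _ ≤ (1 / 2) * ‖n₁ - n₂‖ * (1 + |y|) := by gcongr; linarith
  -- the fixed point
  set nstar := ContractingWith.fixedPoint Φ hcontr with hnstar
  have hfix : Φ nstar = nstar := hcontr.fixedPoint_isFixedPt
  have hfix' : ∀ y, sOf nstar y = mOf nstar y := by
    intro y
    have := congrArg (fun f : BoundedContinuousFunction ℝ ℂ => f y) hfix
    simp only [hΦapply] at this
    have hne : ((1 + |y| : ℝ) : ℂ) ≠ 0 := by exact_mod_cast (hw y).ne'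
    simp only [hmOf]
    rw [← this, mul_div_cancel₀ _ hne]
  -- size of the fixed point
  have hnorm : ‖nstar‖ ≤ 2 * CV' := by
    have h1 : ‖Φ nstar‖ ≤ CV' * G nstar :=
      (BoundedContinuousFunction.norm_le (by positivity)).2 fun y => by rw [hΦapply]; exact hΦb nstar y
    rw [hfix] at h1
    simp only [hG] at h1
    nlinarith [h1, hhsmall, norm_nonneg nstar, hCV'0.le]
  -- the answer
  refine ⟨mOf nstar, ωOf nstar, hmOfc nstar, fun y => (hmOfb nstar y).trans
    (mul_le_mul_of_nonneg_right hnorm (hw y).le), (hωOf nstar).1, ?_, fun y => ?_⟩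
  · refine GaussBound.mono (hωG nstar) ?_
    rw [mul_div_assoc, mul_div_assoc]
    exact mul_le_mul_of_nonneg_left (div_le_div_of_nonneg_right hnorm hℓ.le) (by positivity)
  · -- the fixed-point equation in resolvent form
    have hint1 := integrableOn_kernel hα hVc hVb (hsc nstar) (hsb nstar) y
    have hint2 := hJint nstar y
    have hdec : ∀ t, (volterraKernel α (t - y) : ℂ) * ((Real.exp (α * t) : ℂ) * ωOf nstar t) =
        -((volterraKernel α (t - y) : ℂ) * V t * sOf nstar t) + (h : ℂ) *
          ((volterraKernel α (t - y) : ℂ) * (Real.exp (α * t) : ℂ) * (ou α (ωOf nstar) t / (lam + I * U t))) := by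
      intro t
      have hd := resSol_decomp (hωOf nstar).1 hlam0 t
      have hω : ωOf nstar t = FOf nstar t / (lam + I * U t) + (h : ℂ) * ou α (ωOf nstar) t / (lam + I * U t) := by
        linear_combination hd
      rw [hω, hfix' t]
      have hE : (Real.exp (α * t) : ℂ) * (Real.exp (-(α * t)) : ℂ) = 1 := by
        rw [← Complex.ofReal_mul, ← Real.exp_add, add_neg_cancel, Real.exp_zero, Complex.ofReal_one]
      simp only [hFOf, hV, div_eq_mul_inv]
      linear_combination (-(I * (Upp t : ℂ) * mOf nstar t * (volterraKernel α (t - y) : ℂ) *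
        (lam + I * (U t : ℂ))⁻¹)) * hE
    calc mOf nstar y = sOf nstar y := (hfix' y).symm
      _ = gOf nstar y + ∫ t in Ioi y, (volterraKernel α (t - y) : ℂ) * V t * sOf nstar t := hseq nstar y
      _ = 1 - ∫ t in Ioi y, (volterraKernel α (t - y) : ℂ) * ((Real.exp (α * t) : ℂ) * ωOf nstar t) := by
          simp only [hgOf, hJOf]
          rw [integral_congr_ae (ae_of_all _ hdec) |>.trans
            (integral_add hint1.neg (hint2.const_mul _)), MeasureTheory.integral_neg, MeasureTheory.integral_const_mul]
          ring

end Summit.AnomalousDissipation.AnomalousDissipation.Theorems.BurgersLayerKH.Sheet.Strained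

end
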